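import Literature.IUT.LogVolume.Theorem110
import Summits.ABC.IUTFork.Cor312ProvenanceL
import Summits.ABC.IUTFork.Cor312ProvenanceQ
import HarnessLib

/-!
# [IUTchIII] Cor. 3.12 (verbatim, for an initial Θ-datum) ⟹ [IUTchIV] Thm. 1.10's displayed inequalities — the EDGE over the provenance link (c312 crew, wave 2, W2-F companion)

Record-only companion (seat abc-iut-c312-8; board row W2-F); TAKES NO SIDE on Cor. 3.12. Campaign S (abc-iut-S3,
`Literature/IUT/LogVolume/Theorem110.lean`) proved [IUTchIV] Theorem 1.10 as the kernel-checked implication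
`theorem110 : ProofData → IsEtaPrm η_prm → l ≠ 5 → Cor312 → CThetaAdmissible ∧ −1 ≤ C_Θ ∧ Display ∧ DisplayF` for a
`Thm110Numerics` carrier whose `Cor312` field is THE disputed hypothesis. `Cor312Provenance.lean` attached those
numerics to an initial Θ-datum `D` ([IUTchI] Def. 3.1, abc-iut-L5-t2) and a Cor. 3.12 setting `P` (abc-iut-c312-7's
VERBATIM `Cor312.Setting`): `numericsOf D P J` with `numericsOf_cor312_iff : (numericsOf D P J).Cor312 ↔ P.Statement`
under `IsSettingOf D P`. This file composes the two — **the edge "[IUTchIII] Cor. 3.12, as printed, for the situation of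
`D` ⟹ [IUTchIV] Thm. 1.10's displays for `D`"** — with EVERY side condition either printed data of Thm. 1.10
(`ProofData` = its Steps (ii)–(vii) inputs; `IsEtaPrm` = Prop. 1.6's constant, PROVED to exist by S3; the [IUTchIV]-side
numbers `NumericsInputs`) or DISCHARGED here from the datum: "`l ≠ 5`" from "the `(3·5)`-torsion points of `E_F` are
defined over `F`" (p. 22; `Cor312ProvenanceL.l_ne_five_of_torsion15_fixed` / `torsionFixed_of_rational`), "`log(q) > 0`"
(`Cor312ProvenanceQ.logq_pos`), `𝕍(F)^bad` finite (`vFbad_finite`). Nothing is asserted about any elliptic curve: the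
displays follow FROM `P.Statement`, which the tree does not prove. [claim: Mochizuki2012, status: disputed]
-/

noncomputable section

namespace Summit.ABC.IUTFork.Cor312Prov

open Literature.IUT.HodgeTheaters Literature.IUT.LogVolume
open scoped Classical

universe u v w

variable {F : Type u} {K : Type v} {Fbar : Type w} [Field F] [NumberField F] [Field K] [NumberField K]
  [Algebra F K] [Field Fbar] [Algebra F Fbar] [Algebra K Fbar] {E : WeierstrassCurve F} [E.IsElliptic]
  {l : ℕ} {Pb : BadPlacePredicates K}
  {D : InitialThetaData F K Fbar E l Pb} {T : Thm311.ThetaIndex} {S : Thm311.Situation T} {P : Cor312.Setting S}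

/-- `NumericsInputs` with its `logq_pos` field supplied by the theorem `logq_pos D` (`Cor312ProvenanceQ`): only the
[IUTchIV]-side numbers `e_mod, η_prm, log(𝔡^{F_tpd}), log(𝔣^{F_tpd}), log(𝔡^F), log(𝔣^F)` remain inputs.
[claim: Mochizuki2012, status: disputed] -/
def NumericsInputs.ofData (D : InitialThetaData F K Fbar E l Pb) (emod : ℕ) (h1 : 1 ≤ emod) (h2 : emod ≤ dmod E)
    (etaPrm : ℝ) (hη : 0 < etaPrm) (logDiffTpd logCondTpd logDiffF logCondF : ℝ) (ha : 0 ≤ logDiffTpd)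
    (hb : 0 ≤ logCondTpd) (hc : 0 ≤ logDiffF) (hd : 0 ≤ logCondF) : NumericsInputs D where
  emod := emod
  one_le_emod := h1
  emod_le_dmod := h2
  etaPrm := etaPrm
  etaPrm_pos := hη
  logDiffTpd := logDiffTpd
  logDiffTpd_nonneg := ha
  logCondTpd := logCondTpd
  logCondTpd_nonneg := hb
  logDiffF := logDiffF
  logDiffF_nonneg := hc
  logCondF := logCondF
  logCondF_nonneg := hd
  logq_pos := Summit.ABC.IUTFork.Cor312Prov.logq_pos D

/-- **THE EDGE** "[IUTchIII] Cor. 3.12 (as printed, for the situation `P` of the initial Θ-datum `D`) ⟹ [IUTchIV] Thm. 1.10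
for `D`": under the provenance link `IsSettingOf D P`, the VERBATIM `P.Statement`, together with Thm. 1.10's own printed inputs
— the proof data of Steps (ii)–(vii) (S3's `ProofData`), "`η_prm` the positive real number of Proposition 1.6" (`IsEtaPrm`),
and "the `(3·5)`-torsion points of `E_F` are defined over `F`" (Galois-fixed form, whence `l ≠ 5`) — yields all four
conclusions of S3's `theorem110`: one may take `C_Θ` to be the printed constant, `C_Θ ≥ −1`, and both displayed
inequalities. PROVED (composition of `numericsOf_cor312_iff` with `Literature.IUT.LogVolume.Thm110Numerics.theorem110`).
[claim: Mochizuki2012, status: disputed] -/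
theorem theorem110_of_statement (h : IsSettingOf D P) (J : NumericsInputs D)
    (PD : (numericsOf D P J).ProofData) (hη : IsEtaPrm J.etaPrm) (h15 : TorsionFixed E Fbar 15)
    (hstat : P.Statement) :
    (numericsOf D P J).CThetaAdmissible ∧ -1 ≤ (numericsOf D P J).CTheta ∧
      (numericsOf D P J).Display ∧ (numericsOf D P J).DisplayF :=
  Thm110Numerics.theorem110 PD hη (l_ne_five_of_torsion15_fixed D h15) ((numericsOf_cor312_iff P J h).mpr hstat)

/-- The same edge with "defined over `F`" in the RANGE-OF-BASE-CHANGE phrasing (abc-iut-L5-t2's convention for [IUTchI]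
Def. 3.1 (b)). PROVED. [claim: Mochizuki2012, status: disputed] -/
theorem theorem110_of_statement' (h : IsSettingOf D P) (J : NumericsInputs D)
    (PD : (numericsOf D P J).ProofData) (hη : IsEtaPrm J.etaPrm)
    (h15 : ∀ Q : GeomPoints Fbar E, (15 : ℤ) • Q = 0 →
      Q ∈ Set.range (WeierstrassCurve.Affine.Point.baseChange (W' := E.toAffine) F Fbar))
    (hstat : P.Statement) :
    (numericsOf D P J).CThetaAdmissible ∧ -1 ≤ (numericsOf D P J).CTheta ∧
      (numericsOf D P J).Display ∧ (numericsOf D P J).DisplayF :=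
  theorem110_of_statement h J PD hη (torsionFixed_of_rational h15) hstat

/-- The first display alone, spelled out: `(1/6)·log(q) ≤ (1 + 20·d_mod/l)·(log(𝔡^{F_tpd}) + log(𝔣^{F_tpd})) + 20·(e*_mod·l + η_prm)`
for the numerics OF `D` — with `log(q)` the datum's (`numericsOf_logq`). PROVED (from the edge). [claim: Mochizuki2012, status: disputed] -/
theorem display_of_statement (h : IsSettingOf D P) (J : NumericsInputs D)
    (PD : (numericsOf D P J).ProofData) (hη : IsEtaPrm J.etaPrm) (h15 : TorsionFixed E Fbar 15)
    (hstat : P.Statement) : (numericsOf D P J).Display :=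
  (theorem110_of_statement h J PD hη h15 hstat).2.2.1

end Summit.ABC.IUTFork.Cor312Prov

end
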